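import Summits.Ventures.PercRepro.RankLevelSetExplicitLinArithA
import Mathlib.Analysis.Complex.ExponentialBounds

/-!
# PercRepro — THE ARITHMETIC OF THEOREM P⁗″, PART A: THE THRESHOLD `Tq q = q·2^{q+1}`, THE EXPONENTIAL POWER
BOUNDS, THE DECAY LEMMAS AND THE VANDERMONDE TAIL OVER ALL `k ≥ 3` (p9, S4)

`proofs/SUBCLAIM-S4-p9.md` §S4.2⁗′. THEOREM P⁗′ (`RankLevelSetExplicitLin`, `Plin q ≤ 20·q·2^q + 1`) bounds the big
class with the cap only (`|X| ≤ q + d`) and the crude Vandermonde `C(d+q,3)·C(…, q−2)`, and never lets either weight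
decay past its saturation corank. THEOREM P⁗″ puts LOCAL SPARSITY WITH THE CATALOGUE BOUND `f(q) ≤ 5·2^{q−3} − 1`
(the tree's `f(6) ≤ 39` and the cover step `f(k+1) ≤ 2f(k) + 1`) into BOTH classes, bounds the big class by LEMMA T_k
at every `k ≥ 3` (one binomial `C((q+3)d + 2q − 2, q)` after Vandermonde), and keeps the decay `2^{μ−d}` of each weight
past its saturation corank `μ`. The threshold drops from `20·q·2^q` to `q·2^{q+1}` at every level `q ≥ 8`. This file:
the elementary arithmetic. Axioms: standard (the exponential bounds are Mathlib's `Real.add_one_le_exp`,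
`Real.exp_one_lt_d9`).
-/

namespace PercRepro

namespace ThmN

namespace Explicit

/-- **THE THRESHOLD OF THEOREM P⁗″**: `Tq q = q·2^{q+1}` (`Tq 8 = 4 096`, `Tq 9 = 9 216`, `Tq 10 = 20 480`,
`Tq 20 = 41 943 040`). -/
def Tq (q : ℕ) : ℕ := q * 2 ^ (q + 1)

/-- `Tq q + 1 ≤ Tq (q + 1)`. -/
theorem Tq_succ_le (q : ℕ) : Tq q + 1 ≤ Tq (q + 1) := by
  unfold Tq
  have h1 : 1 ≤ 2 ^ (q + 1) := Nat.one_le_two_pow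
  calc q * 2 ^ (q + 1) + 1 ≤ q * 2 ^ (q + 1) + 2 ^ (q + 1) := by omega
    _ = (q + 1) * 2 ^ (q + 1) := by ring
    _ ≤ (q + 1) * 2 ^ (q + 1 + 1) := Nat.mul_le_mul_left _ (Nat.pow_le_pow_right (by norm_num) (by omega))

/-- `q ≤ 2^{q−4}` for `q ≥ 7` (so `5·2^{q−4} − q ≥ 4·2^{q−4}`). -/
theorem le_two_pow_sub_four (q : ℕ) (hq : 7 ≤ q) : q ≤ 2 ^ (q - 4) := by
  induction q, hq using Nat.le_induction with
  | base => norm_num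
  | succ q hq ih =>
    rw [show q + 1 - 4 = q - 4 + 1 by omega, pow_succ]
    omega

/-- `q + 3 ≤ 2^{q−4}` for `q ≥ 8`. -/
theorem add_three_le_two_pow_sub_four (q : ℕ) (hq : 8 ≤ q) : q + 3 ≤ 2 ^ (q - 4) := by
  induction q, hq using Nat.le_induction with
  | base => norm_num
  | succ q hq ih =>
    rw [show q + 1 - 4 = q - 4 + 1 by omega, pow_succ]
    omega

/-- The two-power facts at `q ≥ 8`: `2^q = 8·2^{q−3} = 16·2^{q−4}`, `q + 3 ≤ 2^{q−4}`, `2^{q−3} = 2·2^{q−4}`. -/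
theorem two_pow_facts2 (q : ℕ) (hq : 8 ≤ q) :
    2 ^ q = 8 * 2 ^ (q - 3) ∧ 2 ^ q = 16 * 2 ^ (q - 4) ∧ q + 3 ≤ 2 ^ (q - 4) ∧ 2 ^ (q - 3) = 2 * 2 ^ (q - 4) := by
  have h3 := add_three_le_two_pow_sub_four q hq
  obtain ⟨r, rfl⟩ : ∃ r, q = r + 8 := ⟨q - 8, by omega⟩
  simp only [show r + 8 - 3 = r + 5 by omega, show r + 8 - 4 = r + 4 by omega] at h3 ⊢
  refine ⟨by ring, by ring, h3, by ring⟩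

/-- The bounds the chain needs from `Tq q ≤ p` at `q ≥ 8`: `N₁(q) ≤ Tq q`, the tail room, `2q·2^q ≤ Tq q`, `q + 3 ≤ Tq q`. -/
theorem Tq_bounds (q : ℕ) (hq : 8 ≤ q) :
    2 ^ (q + 1) + 2 * q ^ 2 + 4 * q + 4 ≤ Tq q ∧ 3 * (2 * q + 2 ^ q) + 5 ≤ Tq q ∧ 2 * q * 2 ^ q ≤ Tq q ∧
      q + 3 ≤ Tq q := by
  unfold Tq
  have h8 : 2 ^ 8 ≤ 2 ^ q := Nat.pow_le_pow_right (by norm_num) hq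
  have hx := le_two_pow_sub_four q (by omega)
  obtain ⟨_, h16, _, _⟩ := two_pow_facts2 q hq
  rw [pow_succ]
  refine ⟨?_, ?_, by ring_nf; omega, ?_⟩
  · -- `2^{q+1} + 2q² + 4q + 4 ≤ 2q·2^q`: `2q² ≤ q·2^{q−4}·2 …`
    have hq2 : q ^ 2 ≤ q * 2 ^ (q - 4) := by nlinarith
    nlinarith
  · nlinarith
  · nlinarith

/-- The powers of `p ≥ Tq q`: `4q²(2^q)² ≤ p²`, `8q³(2^q)³ ≤ p³`, `16q⁴(2^q)⁴ ≤ p⁴`, `1 ≤ p`. -/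
theorem p_lin2_bounds (q p : ℕ) (hq : 8 ≤ q) (hp : Tq q ≤ p) :
    4 * q ^ 2 * (2 ^ q) ^ 2 ≤ p ^ 2 ∧ 8 * q ^ 3 * (2 ^ q) ^ 3 ≤ p ^ 3 ∧ 16 * q ^ 4 * (2 ^ q) ^ 4 ≤ p ^ 4 ∧
      1 ≤ p := by
  have h : 2 * q * 2 ^ q ≤ p := by unfold Tq at hp; rw [pow_succ] at hp; nlinarith
  have h1 : 1 ≤ p := by have := Nat.one_le_two_pow (n := q); nlinarith
  refine ⟨?_, ?_, ?_, h1⟩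
  · calc 4 * q ^ 2 * (2 ^ q) ^ 2 = (2 * q * 2 ^ q) ^ 2 := by ring
      _ ≤ p ^ 2 := Nat.pow_le_pow_left h 2
  · calc 8 * q ^ 3 * (2 ^ q) ^ 3 = (2 * q * 2 ^ q) ^ 3 := by ring
      _ ≤ p ^ 3 := Nat.pow_le_pow_left h 3
  · calc 16 * q ^ 4 * (2 ^ q) ^ 4 = (2 * q * 2 ^ q) ^ 4 := by ring
      _ ≤ p ^ 4 := Nat.pow_le_pow_left h 4

/-! ### The exponential power bounds `(a + m)^k ≤ e^{km/a}·a^k` -/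

/-- `(a + m)^k ≤ exp(k·m/a)·a^k` for real `a > 0`, `m ≥ 0`. -/
theorem add_pow_le_exp_mul_pow (a m : ℝ) (ha : 0 < a) (hm : 0 ≤ m) (k : ℕ) :
    (a + m) ^ k ≤ Real.exp (k * (m / a)) * a ^ k := by
  have h1 : a + m = a * (1 + m / a) := by field_simp
  have h2 : 1 + m / a ≤ Real.exp (m / a) := by
    have := Real.add_one_le_exp (m / a); linarith
  have h3 : (1 + m / a) ^ k ≤ Real.exp (m / a) ^ k :=
    pow_le_pow_left₀ (by positivity) h2 k
  rw [h1, mul_pow, Real.exp_nat_mul]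
  nlinarith [pow_nonneg ha.le k, pow_nonneg (show (0:ℝ) ≤ 1 + m / a by positivity) k]

/-- `exp 1 ≤ 2.72`, `exp 2 ≤ 8`, `exp 5 ≤ 149`, `exp (1/2) ≤ 2` numerically. -/
theorem exp_bounds : Real.exp 1 ≤ 2.72 ∧ Real.exp 2 ≤ 8 ∧ Real.exp 5 ≤ 149 ∧ Real.exp (1 / 2) ≤ 2 := by
  have h1 : Real.exp 1 ≤ 2.72 := by have := Real.exp_one_lt_d9; norm_num at this ⊢; linarith
  have h0 : 0 ≤ Real.exp 1 := (Real.exp_pos 1).le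
  refine ⟨h1, ?_, ?_, ?_⟩
  · have : Real.exp 2 = Real.exp 1 ^ 2 := by rw [← Real.exp_nat_mul]; norm_num
    rw [this]; nlinarith
  · have : Real.exp 5 = Real.exp 1 ^ 5 := by rw [← Real.exp_nat_mul]; norm_num
    rw [this]
    have h2 : Real.exp 1 ^ 2 ≤ 2.72 ^ 2 := pow_le_pow_left₀ h0 h1 2
    have h3 : Real.exp 1 ^ 5 ≤ 2.72 ^ 5 := pow_le_pow_left₀ h0 h1 5
    norm_num at h3 ⊢; linarith
  · have : Real.exp (1 / 2) ^ 2 = Real.exp 1 := by rw [← Real.exp_nat_mul]; norm_num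
    nlinarith [Real.exp_pos (1 / 2)]

/-- The `ℕ`-form: `(a + m)^k ≤ c·a^k` whenever `k·m ≤ r·a` and `exp r ≤ c`. -/
theorem add_pow_le_mul_pow_of_exp (a m k : ℕ) (r c : ℝ) (hc : Real.exp r ≤ c)
    (h : (k : ℝ) * m ≤ r * a) (ha : 0 < a) : ((a + m) ^ k : ℝ) ≤ c * (a : ℝ) ^ k := by
  have ha' : (0 : ℝ) < a := by exact_mod_cast ha
  have hm : (0 : ℝ) ≤ m := by positivity
  have h1 := add_pow_le_exp_mul_pow (a : ℝ) (m : ℝ) ha' hm k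
  have h2 : (k : ℝ) * ((m : ℝ) / a) ≤ r := by
    rw [← mul_div_assoc, div_le_iff₀ ha']; exact h
  have h3 : Real.exp ((k : ℝ) * ((m : ℝ) / a)) ≤ c := (Real.exp_le_exp.2 h2).trans hc
  calc ((a : ℝ) + m) ^ k ≤ Real.exp ((k : ℝ) * ((m : ℝ) / a)) * (a : ℝ) ^ k := h1
    _ ≤ c * (a : ℝ) ^ k := by gcongr

/-- `(a + m)^k ≤ 2·a^k` when `2·k·m ≤ a` (`exp (1/2) < 2`). -/
theorem add_pow_le_two_mul_pow (a m k : ℕ) (h : 2 * k * m ≤ a) : (a + m) ^ k ≤ 2 * a ^ k := by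
  rcases Nat.eq_zero_or_pos a with rfl | ha
  · rcases k with _ | k
    · simp
    · have h1 : m ≤ (k + 1) * m := Nat.le_mul_of_pos_left m (by omega)
      have hm : m = 0 := by
        have h0 : 2 * ((k + 1) * m) ≤ 0 := by rw [← mul_assoc]; exact h
        omega
      subst hm; simp
  · have h' : (k : ℝ) * m ≤ (1 / 2 : ℝ) * a := by
      have : ((2 * k * m : ℕ) : ℝ) ≤ (a : ℝ) := by exact_mod_cast h
      push_cast at this; linarith
    have := add_pow_le_mul_pow_of_exp a m k (1 / 2) 2 exp_bounds.2.2.2 h' ha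
    exact_mod_cast this

/-- `(a + m)^k ≤ 8·a^k` when `k·m ≤ 2a` (`exp 2 < 8`). -/
theorem add_pow_le_eight_mul_pow (a m k : ℕ) (h : k * m ≤ 2 * a) : (a + m) ^ k ≤ 8 * a ^ k := by
  rcases Nat.eq_zero_or_pos a with rfl | ha
  · rcases k with _ | k
    · simp
    · have h1 : m ≤ (k + 1) * m := Nat.le_mul_of_pos_left m (by omega)
      have hm : m = 0 := by
        have h0 : (k + 1) * m ≤ 0 := by omega
        omega
      subst hm; simp
  · have h' : (k : ℝ) * m ≤ (2 : ℝ) * a := by exact_mod_cast h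
    have := add_pow_le_mul_pow_of_exp a m k 2 8 exp_bounds.2.1 h' ha
    exact_mod_cast this

/-- `(a + m)^k ≤ 149·a^k` when `k·m ≤ 5a` (`exp 5 < 149`). -/
theorem add_pow_le_one_forty_nine_mul_pow (a m k : ℕ) (h : k * m ≤ 5 * a) : (a + m) ^ k ≤ 149 * a ^ k := by
  rcases Nat.eq_zero_or_pos a with rfl | ha
  · rcases k with _ | k
    · simp
    · have h1 : m ≤ (k + 1) * m := Nat.le_mul_of_pos_left m (by omega)
      have hm : m = 0 := by
        have h0 : (k + 1) * m ≤ 0 := by omega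
        omega
      subst hm; simp
  · have h' : (k : ℝ) * m ≤ (5 : ℝ) * a := by exact_mod_cast h
    have := add_pow_le_mul_pow_of_exp a m k 5 149 exp_bounds.2.2.1 h' ha
    exact_mod_cast this

/-- **THE DECAY LEMMA**: `(m + t)^k ≤ m^k·2^t` when `2k ≤ m`. -/
theorem add_pow_le_pow_mul_two_pow (m k : ℕ) (h : 2 * k ≤ m) : ∀ t, (m + t) ^ k ≤ m ^ k * 2 ^ t := by
  intro t
  induction t with
  | zero => simp
  | succ t ih =>
    have h1 : (m + t + 1) ^ k ≤ 2 * (m + t) ^ k :=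
      add_pow_le_two_mul_pow (m + t) 1 k (by omega)
    calc (m + (t + 1)) ^ k = (m + t + 1) ^ k := by ring_nf
      _ ≤ 2 * (m + t) ^ k := h1
      _ ≤ 2 * (m ^ k * 2 ^ t) := Nat.mul_le_mul_left _ ih
      _ = m ^ k * 2 ^ (t + 1) := by ring

/-- The shifted decay for `k ≤ 4`: `(m + t)^k ≤ m^k·2^{t−4}` when `8 ≤ m`, `8 ≤ t`. -/
theorem add_pow_le_pow_mul_two_pow_sub_four (m t k : ℕ) (hm : 8 ≤ m) (ht : 8 ≤ t) (hk : k ≤ 4) :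
    (m + t) ^ k ≤ m ^ k * 2 ^ (t - 4) := by
  obtain ⟨s, rfl⟩ : ∃ s, t = s + 8 := ⟨t - 8, by omega⟩
  have h1 : (m + 8) ^ k ≤ m ^ k * 16 := by
    calc (m + 8) ^ k ≤ (2 * m) ^ k := Nat.pow_le_pow_left (by omega) k
      _ = 2 ^ k * m ^ k := by rw [mul_pow]
      _ ≤ 16 * m ^ k := Nat.mul_le_mul_right _ (by
          calc 2 ^ k ≤ 2 ^ 4 := Nat.pow_le_pow_right (by norm_num) hk
            _ = 16 := by norm_num)
      _ = m ^ k * 16 := by ring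
  have h2 := add_pow_le_pow_mul_two_pow (m + 8) k (by omega) s
  rw [show s + 8 - 4 = s + 4 by omega, show m + (s + 8) = m + 8 + s by ring]
  calc (m + 8 + s) ^ k ≤ (m + 8) ^ k * 2 ^ s := h2
    _ ≤ m ^ k * 16 * 2 ^ s := Nat.mul_le_mul_right _ h1
    _ = m ^ k * 2 ^ (s + 4) := by ring

/-! ### Binomials against powers -/

/-- `k!·C(N, k) ≤ N^k`. -/
theorem factorial_mul_choose_le_pow (N k : ℕ) : k.factorial * N.choose k ≤ N ^ k := by
  rw [← Nat.descFactorial_eq_factorial_mul_choose]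
  exact Nat.descFactorial_le_pow N k

/-- The ratio lemma with the constant `8`: `C(p + j + 1 + m, j) ≤ 8·C(p + j, j)` when `j(m + 1) ≤ 2(p + 1)`. -/
theorem choose_le_eight_mul_choose (j m p : ℕ) (h : j * (m + 1) ≤ 2 * (p + 1)) :
    (p + j + 1 + m).choose j ≤ 8 * (p + j).choose j := by
  have hR := choose_mul_pow_le_choose_mul_pow p j (j + 1 + m) (by omega)
  rw [show j + 1 + m - j = m + 1 by omega, show p + (j + 1 + m) = p + j + 1 + m by omega] at hR
  have hB := add_pow_le_eight_mul_pow (p + 1) (m + 1) j h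
  have hpos : 0 < (p + 1) ^ j := by positivity
  apply Nat.le_of_mul_le_mul_right _ hpos
  calc (p + j + 1 + m).choose j * (p + 1) ^ j ≤ (p + j).choose j * (p + 1 + (m + 1)) ^ j := hR
    _ ≤ (p + j).choose j * (8 * (p + 1) ^ j) := Nat.mul_le_mul_left _ hB
    _ = 8 * (p + j).choose j * (p + 1) ^ j := by ring

/-- `24·C(x, 4) ≤ x^4`. -/
theorem twentyfour_mul_choose_four_le (x : ℕ) : 24 * x.choose 4 ≤ x ^ 4 := by
  have := factorial_mul_choose_le_pow x 4
  rwa [show (4 : ℕ).factorial = 24 by rfl] at this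

/-! ### The Vandermonde tail over all `k ≥ 3` (LEMMA T_k at every `k`) -/

/-- `Σ_{k ∈ [3, q+1]} C(X, k−1)·C(N, q+1−k) ≤ C(X + N, q)` (a partial Vandermonde sum). -/
theorem sum_choose_mul_choose_le_add_choose (X N q : ℕ) :
    ∑ k ∈ Finset.Icc 3 (q + 1), X.choose (k - 1) * N.choose (q + 1 - k) ≤ (X + N).choose q := by
  rw [Nat.add_choose_eq]
  -- re-index `k ↦ (k − 1, q + 1 − k)` into the antidiagonal of `q`
  have himg : ∑ k ∈ Finset.Icc 3 (q + 1), X.choose (k - 1) * N.choose (q + 1 - k) =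
      ∑ ij ∈ (Finset.Icc 3 (q + 1)).image (fun k => (k - 1, q + 1 - k)), X.choose ij.1 * N.choose ij.2 := by
    rw [Finset.sum_image]
    intro a ha b hb hab
    rw [Finset.mem_coe, Finset.mem_Icc] at ha hb
    obtain ⟨h1, _⟩ := Prod.ext_iff.1 hab
    simp only at h1
    omega
  rw [himg]
  apply Finset.sum_le_sum_of_subset_of_nonneg
  · intro ij hij
    rw [Finset.mem_image] at hij
    obtain ⟨k, hk, rfl⟩ := hij
    rw [Finset.mem_Icc] at hk
    exact Finset.HasAntidiagonal.mem_antidiagonal.2 (by show k - 1 + (q + 1 - k) = q; omega)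
  · intros; positivity

/-- **THE `T_k` TAIL AT EVERY `k ≥ 3`**: `Σ_{k=3}^{q+1} 2^{k−1}·C(d+k−2, k−1)·C(N, q+1−k) ≤ C(2d+2q−2+N, q)`
(the doubling lemma, the monotonicity of the top index, the partial Vandermonde sum). -/
theorem tail_sum_le_sparse_all (q d N : ℕ) :
    ∑ k ∈ Finset.Icc 3 (q + 1), 2 ^ (k - 1) * (d + k - 2).choose (k - 1) * N.choose (q + 1 - k) ≤
      (2 * d + 2 * q - 2 + N).choose q := by
  refine le_trans (Finset.sum_le_sum (fun k hk => ?_)) (sum_choose_mul_choose_le_add_choose (2 * d + 2 * q - 2) N q)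
  rw [Finset.mem_Icc] at hk
  have h1 : 2 ^ (k - 1) * (d + k - 2).choose (k - 1) ≤ (2 * (d + k - 2)).choose (k - 1) :=
    two_pow_mul_choose_le_choose_two_mul (d + k - 2) (k - 1)
  have h2 : (2 * (d + k - 2)).choose (k - 1) ≤ (2 * d + 2 * q - 2).choose (k - 1) :=
    Nat.choose_le_choose _ (by omega)
  exact Nat.mul_le_mul_right _ (h1.trans h2)

/-- **The power comparison of the big class**: `19072·5^{q−1} ≤ 16^q` for `q ≥ 8`. -/
theorem big_const_le2 (q : ℕ) (hq : 8 ≤ q) : 19072 * 5 ^ (q - 1) ≤ 16 ^ q := by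
  induction q, hq using Nat.le_induction with
  | base => norm_num
  | succ q hq ih =>
    rw [show q + 1 - 1 = q - 1 + 1 by omega, pow_succ, pow_succ]
    calc 19072 * (5 ^ (q - 1) * 5) = 19072 * 5 ^ (q - 1) * 5 := by ring
      _ ≤ 16 ^ q * 5 := Nat.mul_le_mul_right _ ih
      _ ≤ 16 ^ q * 16 := Nat.mul_le_mul_left _ (by norm_num)

end Explicit

end ThmN

end PercRepro
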